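import Summits.CriticalPhenomena.PercolationContinuityZ3.Theorems.PercNearOneGluingNoHeavyLowerTailSahiThreeCopyTwoPointCertsK4

/-!
# Sahi's three-function conjecture — the free-slot property `FrontGood` and its reductions (relabelling, frozen front
# coordinates), with the boundary profiles at `k = 5` reduced to the `k = 4` theorem

Infrastructure for the `k = 5` certificate theorem (companion of `…TwoPointCertsK4`, `…TwoPointFlow`).
`FrontGood k π f` := for every back cube `{0,1}^d`, every back profile `b` and all nonnegative monotone `G, H` on `{0,1}^{d+k}`,
`0 ≤ c_{(π,b)}(frontFn k f, G, H)`.  Proved here (all `k`, pure bookkeeping):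
* closed forms `appendProf_apply_front/back`, `frontFn_apply`; the lifted permutation `liftPerm` of the big cube acting on
  the front block, `appendProf_comp_liftPerm`, `frontFn_comp_relab_liftPerm`, and ★ `frontGood_relab`
  (`FrontGood k π (f ∘ relab σ) → FrontGood k (π ∘ σ) f`, via `tc_relab`);
* ★ `frontGood_cons_zero` / `frontGood_cons_three`: a front coordinate with profile `0` (resp. `3`) is frozen — the property
  for `(π, f)` on `k+1` front coordinates follows from the property for `(tail π, f(0,·))` (resp. `f(1,·)`) on `k`
  (`tc_cons_zero/three` + `sec_frontFn_succ`); `frontGood_of_four_le` (empty arrangements);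
* sections of up-set indicators (`secSet`, `setInd_cons_eq`, `isUpperSet_secSet`);
* ★ `frontGood_five_of_boundary`: for `π : Fin 5 → ℕ` with some `π i ∈ {0} ∪ {3, 4, …}` and every up-set `A ⊆ {0,1}^5`,
  `FrontGood 5 π 1_A` — from `tc_front4_nonneg` (so the `k = 5` certificate table only needs `π ∈ {1,2}^5`).
No `sorry`, standard axioms, nothing conjectural. [this work]
-/

namespace Summit.CriticalPhenomena.PercolationContinuityZ3.Theorems.SahiThreeCopy

open Finset Function Literature.Combinatorics.Sahi2008
open scoped BigOperators

noncomputable section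

section FrontGood

variable {d k : ℕ}

/-- The FREE-SLOT property of `(π, f)` on `k` front coordinates: `0 ≤ c_{(π,b)}(frontFn k f, G, H)` for every back profile `b`
on a cube of any dimension `d` and all nonnegative monotone `G, H`. [this work] -/
def FrontGood (k : ℕ) (π : Fin k → ℕ) (f : Pt k → ℝ) : Prop :=
  ∀ ⦃d : ℕ⦄ (b : Fin d → ℕ) ⦃G H : Pt (d + k) → ℝ⦄, (∀ w, 0 ≤ G w) → (∀ w, 0 ≤ H w) → Monotone G → Monotone H →
    0 ≤ tc (appendProf k π b) (frontFn k f) G H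

/-- A front profile entry `≥ 4` has no arrangements. [this work] -/
theorem frontGood_of_four_le (π : Fin k → ℕ) {i : Fin k} (hi : 4 ≤ π i) (f : Pt k → ℝ) : FrontGood k π f :=
  fun _ b _ _ _ _ _ _ => by rw [tc_frontFn_eq_zero_of_four_le π hi f b]

/-! #### Frozen front coordinates -/

/-- Sections of a front function along front coordinate `0`. [this work] -/
theorem sec_frontFn_succ (f : Pt (k + 1) → ℝ) (ε : Bool) :
    sec (frontFn (d := d) (k + 1) f) ε = frontFn k (fun e => f (Fin.cons ε e)) := by
  funext w; simp only [sec, frontFn, Fin.cons_zero, Fin.tail_cons]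

/-- Peeling the first front profile entry. [this work] -/
theorem appendProf_succ (π : Fin (k + 1) → ℕ) (b : Fin d → ℕ) :
    appendProf (k + 1) π b = Fin.cons (π 0) (appendProf k (Fin.tail π) b) := rfl

/-- ★ Front coordinate `0` frozen at `0`: reduce to the bottom section. [this work] -/
theorem frontGood_cons_zero {π : Fin (k + 1) → ℕ} (h0 : π 0 = 0) {f : Pt (k + 1) → ℝ}
    (hf : FrontGood k (Fin.tail π) (fun e => f (Fin.cons false e))) : FrontGood (k + 1) π f := by
  intro d b G H hG hH hGm hHm
  rw [appendProf_succ, h0, tc_cons_zero, sec_frontFn_succ]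
  exact hf b (sec_nonneg hG _) (sec_nonneg hH _) (sec_monotone hGm _) (sec_monotone hHm _)

/-- ★ Front coordinate `0` frozen at `1`: reduce to the top section. [this work] -/
theorem frontGood_cons_three {π : Fin (k + 1) → ℕ} (h3 : π 0 = 3) {f : Pt (k + 1) → ℝ}
    (hf : FrontGood k (Fin.tail π) (fun e => f (Fin.cons true e))) : FrontGood (k + 1) π f := by
  intro d b G H hG hH hGm hHm
  rw [appendProf_succ, h3, tc_cons_three, sec_frontFn_succ]
  exact hf b (sec_nonneg hG _) (sec_nonneg hH _) (sec_monotone hGm _) (sec_monotone hHm _)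

/-! #### Closed forms and relabelling of the front block -/

/-- Closed form of the concatenated profile on front indices. [this work] -/
theorem appendProf_apply_front : ∀ (k : ℕ) (π : Fin k → ℕ) (b : Fin d → ℕ) (j : ℕ) (hj : j < k) (hj' : j < d + k),
    appendProf k π b ⟨j, hj'⟩ = π ⟨j, hj⟩
  | 0, _, _, _, hj, _ => absurd hj (Nat.not_lt_zero _)
  | k + 1, π, b, 0, _, _ => by simp only [appendProf]; rfl
  | k + 1, π, b, j + 1, hj, hj' => by
    simp only [appendProf]
    have e : (⟨j + 1, hj'⟩ : Fin (d + k + 1)) = Fin.succ ⟨j, by omega⟩ := rfl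
    rw [e, Fin.cons_succ, appendProf_apply_front k (Fin.tail π) b j (by omega)]
    rfl

/-- Closed form of the concatenated profile on back indices. [this work] -/
theorem appendProf_apply_back : ∀ (k : ℕ) (π : Fin k → ℕ) (b : Fin d → ℕ) (j : ℕ) (hj : k ≤ j) (hj' : j < d + k),
    appendProf k π b ⟨j, hj'⟩ = b ⟨j - k, by omega⟩
  | 0, _, _, _, _, _ => rfl
  | k + 1, π, b, 0, hj, _ => absurd hj (by omega)
  | k + 1, π, b, j + 1, hj, hj' => by
    simp only [appendProf]
    have e : (⟨j + 1, hj'⟩ : Fin (d + k + 1)) = Fin.succ ⟨j, by omega⟩ := rfl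
    rw [e, Fin.cons_succ, appendProf_apply_back k (Fin.tail π) b j (by omega)]
    exact congrArg b (Fin.ext (Nat.succ_sub_succ j k).symm)

/-- `appendProf_apply_front` for a `Fin`-valued index. [this work] -/
theorem appendProf_apply_front' (π : Fin k → ℕ) (b : Fin d → ℕ) (j : Fin (d + k)) (hj : (j : ℕ) < k) :
    appendProf k π b j = π ⟨j, hj⟩ :=
  appendProf_apply_front k π b j hj j.isLt

/-- `appendProf_apply_back` for a `Fin`-valued index. [this work] -/
theorem appendProf_apply_back' (π : Fin k → ℕ) (b : Fin d → ℕ) (j : Fin (d + k)) (hj : k ≤ (j : ℕ)) :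
    appendProf k π b j = b ⟨j - k, by omega⟩ :=
  appendProf_apply_back k π b j hj j.isLt

/-- Closed form of a front function: `frontFn k f w = f (front part of w)`. [this work] -/
theorem frontFn_apply : ∀ (k : ℕ) (f : Pt k → ℝ) (w : Pt (d + k)), frontFn k f w = f (fun j => w ⟨j, by omega⟩)
  | 0, f, w => by simp only [frontFn]; congr 1; exact Subsingleton.elim _ _
  | k + 1, f, w => by
    simp only [frontFn]
    rw [frontFn_apply k]
    congr 1
    funext i
    refine Fin.cases ?_ (fun j => ?_) i
    · simp only [Fin.cons_zero]; rfl
    · simp only [Fin.cons_succ, Fin.tail]; rfl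

/-- A permutation of the `k` front coordinates, lifted to the big cube `{0,1}^{d+k}` (identity on the back). [this work] -/
def liftPerm (d k : ℕ) (σ : Equiv.Perm (Fin k)) : Equiv.Perm (Fin (d + k)) where
  toFun j := if h : (j : ℕ) < k then ⟨σ ⟨j, h⟩, Nat.lt_of_lt_of_le (σ ⟨j, h⟩).isLt (Nat.le_add_left k d)⟩ else j
  invFun j := if h : (j : ℕ) < k then ⟨σ.symm ⟨j, h⟩, Nat.lt_of_lt_of_le (σ.symm ⟨j, h⟩).isLt (Nat.le_add_left k d)⟩ else j
  left_inv j := by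
    by_cases h : (j : ℕ) < k
    · simp only [h, dif_pos, Fin.is_lt, Fin.eta, Equiv.symm_apply_apply]
    · simp only [h, dif_neg, not_false_eq_true]
  right_inv j := by
    by_cases h : (j : ℕ) < k
    · simp only [h, dif_pos, Fin.is_lt, Fin.eta, Equiv.apply_symm_apply]
    · simp only [h, dif_neg, not_false_eq_true]

/-- `liftPerm` on a front index. [this work] -/
theorem liftPerm_apply_front (σ : Equiv.Perm (Fin k)) (j : Fin (d + k)) (h : (j : ℕ) < k) :
    (liftPerm d k σ j : ℕ) = σ ⟨j, h⟩ := by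
  simp only [liftPerm, Equiv.coe_fn_mk, h, dif_pos]

/-- `liftPerm` on a back index. [this work] -/
theorem liftPerm_apply_back (σ : Equiv.Perm (Fin k)) (j : Fin (d + k)) (h : ¬ (j : ℕ) < k) : liftPerm d k σ j = j := by
  simp only [liftPerm, Equiv.coe_fn_mk, h, dif_neg, not_false_eq_true]

/-- Relabelling the front block of a concatenated profile. [this work] -/
theorem appendProf_comp_liftPerm (σ : Equiv.Perm (Fin k)) (π : Fin k → ℕ) (b : Fin d → ℕ) :
    appendProf k π b ∘ liftPerm d k σ = appendProf k (π ∘ σ) b := by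
  funext j
  simp only [Function.comp_apply]
  by_cases h : (j : ℕ) < k
  · have h1 := liftPerm_apply_front (d := d) σ j h
    have hlt : (liftPerm d k σ j : ℕ) < k := by rw [h1]; exact (σ ⟨j, h⟩).isLt
    rw [appendProf_apply_front' π b _ hlt, appendProf_apply_front' (π ∘ σ) b _ h]
    simp only [Function.comp_apply]
    congr 1
    exact Fin.ext h1
  · rw [liftPerm_apply_back σ j h, appendProf_apply_back' π b _ (by omega), appendProf_apply_back' (π ∘ σ) b _ (by omega)]

/-- Relabelling the front block of a front function. [this work] -/
theorem frontFn_comp_relab_liftPerm (σ : Equiv.Perm (Fin k)) (f : Pt k → ℝ) :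
    frontFn k f ∘ relab (liftPerm d k σ) = frontFn (d := d) k (f ∘ relab σ) := by
  funext w
  simp only [Function.comp_apply, frontFn_apply, relab_apply]
  congr 1
  funext i
  simp only [Function.comp_apply]
  congr 1
  exact Fin.ext (liftPerm_apply_front (d := d) σ ⟨i, by omega⟩ i.isLt)

/-- ★ **Relabelling transfer for the free-slot property.** [this work] -/
theorem frontGood_relab (σ : Equiv.Perm (Fin k)) {π : Fin k → ℕ} {f : Pt k → ℝ} (h : FrontGood k π (f ∘ relab σ)) :
    FrontGood k (π ∘ σ) f := by
  intro d b G H hG hH hGm hHm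
  rw [← appendProf_comp_liftPerm, tc_relab, frontFn_comp_relab_liftPerm]
  exact h b (fun w => hG _) (fun w => hH _) (monotone_comp_relab _ hGm) (monotone_comp_relab _ hHm)

/-! #### Sections of up-set indicators -/

/-- The section of a family `A ⊆ {0,1}^{k+1}` at first coordinate `ε`. [this work] -/
def secSet (A : Finset (Pt (k + 1))) (ε : Bool) : Finset (Pt k) := univ.filter fun e => Fin.cons ε e ∈ A

/-- The section of an indicator is the indicator of the section. [this work] -/
theorem setInd_cons_eq (A : Finset (Pt (k + 1))) (ε : Bool) : (fun e => setInd A (Fin.cons ε e)) = setInd (secSet A ε) := by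
  funext e; simp only [setInd, secSet, mem_filter, mem_univ, true_and]

/-- Sections of up-sets are up-sets. [this work] -/
theorem isUpperSet_secSet {A : Finset (Pt (k + 1))} (hA : IsUpperSet (A : Set (Pt (k + 1)))) (ε : Bool) :
    IsUpperSet ((secSet A ε : Finset (Pt k)) : Set (Pt k)) := by
  intro x y hxy hx
  rw [Finset.mem_coe] at hx ⊢
  simp only [secSet, mem_filter, mem_univ, true_and] at hx ⊢
  exact hA (Fin.cons_le_cons.2 ⟨le_rfl, hxy⟩) hx

end FrontGood

/-! ### The boundary profiles at `k = 5` -/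

section Five

/-- `k = 4`: the free-slot property for every up-set and every profile (repackaging `tc_front4_nonneg`). [this work] -/
theorem frontGood_four (π : Fin 4 → ℕ) {A : Finset (Pt 4)} (hA : IsUpperSet (A : Set (Pt 4))) : FrontGood 4 π (setInd A) :=
  fun _ b _ _ hG hH hGm hHm => tc_front4_nonneg π hA b hG hH hGm hHm

/-- ★ **Boundary profiles at `k = 5`.**  If some front entry `π i` is `0` or `≥ 3`, the free-slot property of `(π, 1_A)` holds
for every up-set `A ⊆ {0,1}^5` (relabel `i` to the front, freeze it, apply the `k = 4` theorem). [this work] -/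
theorem frontGood_five_of_boundary (π : Fin 5 → ℕ) (i : Fin 5) (hi : π i = 0 ∨ 3 ≤ π i) {A : Finset (Pt 5)}
    (hA : IsUpperSet (A : Set (Pt 5))) : FrontGood 5 π (setInd A) := by
  by_cases h4 : 4 ≤ π i
  · exact frontGood_of_four_le π h4 _
  set σ : Equiv.Perm (Fin 5) := Equiv.swap 0 i with hσ
  have hπ : π = (π ∘ σ) ∘ σ := by
    funext j; simp only [Function.comp_apply, hσ, Equiv.swap_apply_self]
  rw [hπ]
  apply frontGood_relab σ
  rw [setInd_comp_relab]
  have hA' := isUpperSet_map_relab_symm σ hA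
  have h0 : (π ∘ σ) 0 = π i := by simp only [Function.comp_apply, hσ, Equiv.swap_apply_left]
  rcases hi with h | h
  · refine frontGood_cons_zero (by rw [h0, h]) ?_
    rw [setInd_cons_eq]
    exact frontGood_four _ (isUpperSet_secSet hA' _)
  · refine frontGood_cons_three (by rw [h0]; omega) ?_
    rw [setInd_cons_eq]
    exact frontGood_four _ (isUpperSet_secSet hA' _)

end Five

end

end Summit.CriticalPhenomena.PercolationContinuityZ3.Theorems.SahiThreeCopy
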